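import Mathlib
import Literature.NumberTheory.LFunctions.Zhang2022.Section4ContourShift
import HarnessLib

/-!
# Zhang (2022), §4 Lemma 4.4 (proof): tools for the "trivial bounds" on the shifted contours of
# (4.7)–(4.9) — `|Z̃|` off the critical strip (window-free Stirling), `|τ(θ)| ≤ k`, crude
# Dirichlet-polynomial bounds, Gaussian tails of `ω₁`, and the absorption `ℓ^k ≤ e^{ℓ⁹/4}`

Topic `Literature/NumberTheory/LFunctions/Zhang2022` (Landau–Siegel audit tree; verdict-neutral).
Y. Zhang, *Discrete mean estimates and the Landau–Siegel zero*, arXiv:2211.02515v1 (2022)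
[Zhang2022LandauSiegel] — **an unrefereed manuscript under adjudication.** [Z22 p.20, tex L1093,
L1104, L1125]: "By a trivial bound for `ω₁(w)`, (4.5) and the residue theorem we obtain (4.7)", "…
and applying (4.5) and trivial bounds for `ω₁(w)` and the involved sum." This file collects the
quantitative inputs those sentences need, in a form uniform in the contour point (so that the
window mismatch of GAP row G-d04-1 — (4.5) is typed on `|Im(s−s₀)| < 𝓛₁+3` but used up to
`𝓛²⁰` beyond — does not arise):

* `norm_tau_le` — `|τ(θ)| ≤ k`;
* `norm_tildeZW_le_two_mul` — from the tree's window-free `GammaFactor.abs_norm_tildeZ_sub_le`: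
  `|Z̃(z,ψ)| ≤ 2·(p·Dp·(Im z/2π)²)^{1/2 − Re z}` for `|Re z| ≤ 12`, `Im z ≥ 192660`;
* `norm_FpolyBar_le_pow` — `|F(z,ψ̄)| ≤ D⁵⁶` for `Re z ≥ −12`;
* `norm_setIntegral_tails_le` — Gaussian tails: if `|F(v)| ≤ K(1+|v|)²e^{−bv²}` then
  `|∫_{v≤−V}F| + |∫_{v>V}F| ≤ 2K(2 + 8/b)√(π/(3b/8))·e^{−(3b/8)V²}`;
* `pow_ell_le_exp`, `const_le_exp` — absorption of polynomial factors into `e^{𝓛⁹/4} = P^{1/4}`.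

Nothing about Theorems 1–2 of the source or about Landau–Siegel zeros is stated or implied.

## References

* Y. Zhang, arXiv:2211.02515v1 (2022), §4 p. 20 (proof of Lemma 4.4, (4.7)–(4.9)), (4.5).
  [cite: Zhang2022LandauSiegel, §4 Lemma 4.4 (proof)]
-/

noncomputable section

open Complex Real ComplexConjugate MeasureTheory Set intervalIntegral
open scoped Interval

namespace Literature.NumberTheory.LFunctions.Zhang2022.Section4

open Skeleton

/-! ## `|τ(θ)| ≤ k` and `|Z̃|` off the line -/

/-- **`|τ(θ)| ≤ k`** (trivial bound for the Gauss sum: `k` unimodular terms).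
[cite: Zhang2022LandauSiegel, §2 (2.3)] -/
theorem norm_tau_le {k : ℕ} [NeZero k] (θ : DirichletCharacter ℂ k) :
    ‖GammaFactor.tau θ‖ ≤ k := by
  unfold GammaFactor.tau gaussSum
  calc ‖∑ a : ZMod k, θ a * ZMod.stdAddChar a‖
      ≤ ∑ a : ZMod k, ‖θ a * ZMod.stdAddChar a‖ := norm_sum_le _ _
    _ ≤ ∑ _a : ZMod k, (1 : ℝ) := Finset.sum_le_sum fun a _ => by
        rw [norm_mul, ZMod.stdAddChar_apply, Circle.norm_coe, mul_one]
        exact θ.norm_le_one a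
    _ = k := by simp

section WithCharacter

variable {D : ℕ} [NeZero D] (χ : DirichletCharacter ℂ D) (x : Chr D)

/-- **`|Z̃(z,ψ)| ≤ 2(p·Dp·(Im z/2π)²)^{1/2−Re z}`** for `|Re z| ≤ 12` and `Im z ≥ 192660 = 2·570·13²`
— the window-free form of (4.5) (tree `GammaFactor.abs_norm_tildeZ_sub_le` with `A = 12`).
[cite: Zhang2022LandauSiegel, §4 (4.5)] -/
theorem norm_tildeZW_le_two_mul (hprim : (psiChi χ x).IsPrimitive) {z : ℂ} (hre : |z.re| ≤ 12)
    (him : 192660 ≤ z.im) :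
    ‖tildeZW χ x z‖ ≤ 2 * ((x.p : ℝ) * (D * x.p : ℕ) * (z.im / (2 * π)) ^ 2) ^ (1 / 2 - z.re) := by
  have h := GammaFactor.abs_norm_tildeZ_sub_le (k₁ := x.p) (k₂ := D * x.p) x.prim hprim
    (A := 12) (σ := z.re) (t := z.im) (by norm_num) hre (by nlinarith)
  have hz : (z.re : ℂ) + z.im * I = z := Complex.re_add_im z
  rw [hz] at h
  set M : ℝ := ((x.p : ℝ) * (D * x.p : ℕ) * (z.im / (2 * π)) ^ 2) ^ (1 / 2 - z.re) with hM
  have hM0 : 0 ≤ M := by rw [hM]; positivity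
  have ht0 : 0 < z.im := by linarith
  have hcoef : 570 * ((12 : ℝ) + 1) ^ 2 / z.im ≤ 1 := by
    rw [div_le_one ht0]; nlinarith
  have h1 : ‖tildeZW χ x z‖ - M ≤ 570 * ((12 : ℝ) + 1) ^ 2 / z.im * M := (abs_le.mp h).2
  have h2 : 570 * ((12 : ℝ) + 1) ^ 2 / z.im * M ≤ 1 * M :=
    mul_le_mul_of_nonneg_right hcoef hM0
  have h3 : ‖tildeZW χ x z‖ = ‖GammaFactor.tildeZ x.ψ (psiChi χ x) z‖ := rfl
  linarith

omit [NeZero D] in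
/-- **`|F(z,ψ̄)| ≤ D⁵⁶` for `Re z ≥ −12`** (crude: `|ν(n)| ≤ n ≤ D⁴`, `|n^{−z}| ≤ n¹² ≤ D⁴⁸`, `D⁴`
terms). [cite: Zhang2022LandauSiegel, §4 (4.7)] -/
theorem norm_FpolyBar_le_pow (hD : 1 ≤ D) {z : ℂ} (hz : -12 ≤ z.re) :
    ‖FpolyBar χ x z‖ ≤ (D : ℝ) ^ 56 := by
  have hD' : (1 : ℝ) ≤ D := by exact_mod_cast hD
  unfold FpolyBar
  have hterm : ∀ n ∈ Finset.Icc 1 (D ^ 4),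
      ‖nu χ n * conj (x.ψ (n : ZMod x.p)) * (n : ℂ) ^ (-z)‖ ≤ (D : ℝ) ^ 52 := by
    intro n hn
    obtain ⟨h1, h2⟩ := Finset.mem_Icc.mp hn
    have hn1 : (1 : ℝ) ≤ n := by exact_mod_cast h1
    have hn2 : (n : ℝ) ≤ (D : ℝ) ^ 4 := by exact_mod_cast h2
    have hnu : ‖nu χ n‖ ≤ n := by
      refine (Literature.NumberTheory.LFunctions.norm_divisorSumChar_le χ n).trans ?_
      exact_mod_cast Nat.card_divisors_le_self n
    have hψ : ‖conj (x.ψ (n : ZMod x.p))‖ ≤ 1 := by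
      rw [Complex.norm_conj]; exact x.ψ.norm_le_one _
    have hcpow : ‖(n : ℂ) ^ (-z)‖ ≤ (n : ℝ) ^ (12 : ℝ) := by
      rw [Complex.norm_natCast_cpow_of_pos h1, Complex.neg_re]
      exact Real.rpow_le_rpow_of_exponent_le hn1 (by linarith)
    have h12 : (n : ℝ) ^ (12 : ℝ) ≤ ((D : ℝ) ^ 4) ^ (12 : ℝ) :=
      Real.rpow_le_rpow (by linarith) hn2 (by norm_num)
    rw [show ((D : ℝ) ^ 4) ^ (12 : ℝ) = (D : ℝ) ^ 48 by
      rw [show (12 : ℝ) = ((12 : ℕ) : ℝ) by norm_num, Real.rpow_natCast]; ring] at h12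
    calc ‖nu χ n * conj (x.ψ (n : ZMod x.p)) * (n : ℂ) ^ (-z)‖
        = ‖nu χ n‖ * ‖conj (x.ψ (n : ZMod x.p))‖ * ‖(n : ℂ) ^ (-z)‖ := by
          rw [norm_mul, norm_mul]
      _ ≤ (D : ℝ) ^ 4 * 1 * (D : ℝ) ^ 48 := by
          gcongr
          · exact hnu.trans hn2
          · exact hcpow.trans h12
      _ = (D : ℝ) ^ 52 := by ring
  calc ‖∑ n ∈ Finset.Icc 1 (D ^ 4), nu χ n * conj (x.ψ (n : ZMod x.p)) * (n : ℂ) ^ (-z)‖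
      ≤ ∑ n ∈ Finset.Icc 1 (D ^ 4), ‖nu χ n * conj (x.ψ (n : ZMod x.p)) * (n : ℂ) ^ (-z)‖ :=
        norm_sum_le _ _
    _ ≤ ∑ _n ∈ Finset.Icc 1 (D ^ 4), (D : ℝ) ^ 52 := Finset.sum_le_sum hterm
    _ = (D ^ 4 : ℕ) * (D : ℝ) ^ 52 := by simp
    _ = (D : ℝ) ^ 56 := by push_cast; ring

omit [NeZero D] in
/-- The window of a member of `Ψ`: `P < p < 2P`. [cite: Zhang2022LandauSiegel, §2 p. 5] -/
theorem bigP_lt_p_lt_two_mul (hL : 1 ≤ ell D) : bigP D < x.p ∧ (x.p : ℝ) ≤ 2 * bigP D := by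
  have hmem := x.mem
  rw [primeWindow, Finset.mem_filter, Finset.mem_Ioo] at hmem
  obtain ⟨⟨h1, h2⟩, -⟩ := hmem
  have hP0 : 0 ≤ bigP D := (Real.exp_pos _).le
  refine ⟨(Nat.floor_lt hP0).mp h1, (Nat.lt_ceil.mp h2).le.trans ?_⟩
  have hinv : (ell D ^ 68)⁻¹ ≤ 1 := inv_le_one_of_one_le₀ (one_le_pow₀ hL)
  nlinarith

end WithCharacter

/-! ## Gaussian tails -/

/-- `x·e^{−cx} ≤ 1/c` for `x ≥ 0`, `c > 0`. [folklore] -/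
private theorem mul_exp_neg_le {x c : ℝ} (hc : 0 < c) : x * Real.exp (-c * x) ≤ 1 / c := by
  have h1 : c * x ≤ Real.exp (c * x) := by linarith [Real.add_one_le_exp (c * x)]
  rw [show -c * x = -(c * x) by ring, Real.exp_neg, le_div_iff₀ hc]
  have hpos : 0 < Real.exp (c * x) := Real.exp_pos _
  calc x * (Real.exp (c * x))⁻¹ * c = (c * x) / Real.exp (c * x) := by ring
    _ ≤ 1 := (div_le_one hpos).mpr h1

/-- `(1+|v|)² e^{−(b/4)v²} ≤ 2 + 8/b`. [folklore] -/
private theorem one_add_abs_sq_mul_exp_le {b : ℝ} (hb : 0 < b) (v : ℝ) :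
    (1 + |v|) ^ 2 * Real.exp (-(b / 4) * v ^ 2) ≤ 2 + 8 / b := by
  have hsq : (1 + |v|) ^ 2 ≤ 2 + 2 * v ^ 2 := by
    have : |v| ^ 2 = v ^ 2 := sq_abs v
    nlinarith [sq_nonneg (1 - |v|)]
  have he1 : Real.exp (-(b / 4) * v ^ 2) ≤ 1 := by
    rw [Real.exp_le_one_iff]; nlinarith [sq_nonneg v]
  have he0 : 0 < Real.exp (-(b / 4) * v ^ 2) := Real.exp_pos _
  have h2 : v ^ 2 * Real.exp (-(b / 4) * v ^ 2) ≤ 1 / (b / 4) :=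
    mul_exp_neg_le (by positivity)
  calc (1 + |v|) ^ 2 * Real.exp (-(b / 4) * v ^ 2)
      ≤ (2 + 2 * v ^ 2) * Real.exp (-(b / 4) * v ^ 2) := by gcongr
    _ = 2 * Real.exp (-(b / 4) * v ^ 2) + 2 * (v ^ 2 * Real.exp (-(b / 4) * v ^ 2)) := by ring
    _ ≤ 2 * 1 + 2 * (1 / (b / 4)) := by gcongr
    _ = 2 + 8 / b := by ring

/-- **Gaussian tails**: if `|F(v)| ≤ K(1+|v|)²e^{−bv²}` on `ℝ` (`K ≥ 0`, `b > 0`) then for `V ≥ 0`,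
`|∫_{v≤−V} F| + |∫_{v>V} F| ≤ 2K(2 + 8/b)√(π/(3b/8))·e^{−(3b/8)V²}` ("a trivial bound for
`ω₁(w)`" on the far vertical legs). [cite: Zhang2022LandauSiegel, §4 Lemma 4.4 (proof) p. 20] -/
theorem norm_setIntegral_tails_le {F : ℝ → ℂ} {K b V : ℝ} (hK : 0 ≤ K) (hb : 0 < b) (hV : 0 ≤ V)
    (hF : ∀ v : ℝ, ‖F v‖ ≤ K * (1 + |v|) ^ 2 * Real.exp (-b * v ^ 2)) :
    ‖∫ v in Set.Iic (-V), F v‖ + ‖∫ v in Set.Ioi V, F v‖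
      ≤ 2 * (K * (2 + 8 / b) * Real.sqrt (π / (3 * b / 8)) * Real.exp (-(3 * b / 8) * V ^ 2)) := by
  set b' : ℝ := 3 * b / 8 with hb'
  have hb'0 : 0 < b' := by rw [hb']; positivity
  set C : ℝ := K * (2 + 8 / b) * Real.exp (-b' * V ^ 2) with hC
  have hC0 : 0 ≤ C := by rw [hC]; positivity
  -- dominating function on the tails
  set g : ℝ → ℝ := fun v => C * Real.exp (-b' * v ^ 2) with hg
  have hgi : Integrable g := (integrable_exp_neg_mul_sq hb'0).const_mul C
  have hgint : ∫ v, g v = C * Real.sqrt (π / b') := by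
    rw [hg, MeasureTheory.integral_const_mul, integral_gaussian]
  have hg0 : 0 ≤ᵐ[volume] g := ae_of_all _ fun v => by rw [hg]; positivity
  -- the pointwise bound for |v| ≥ V
  have hpt : ∀ v : ℝ, V ≤ |v| → ‖F v‖ ≤ g v := by
    intro v hv
    have hsplit : Real.exp (-b * v ^ 2)
        = Real.exp (-(b / 4) * v ^ 2) * Real.exp (-b' * v ^ 2) * Real.exp (-b' * v ^ 2) := by
      rw [← Real.exp_add, ← Real.exp_add, hb']; congr 1; ring
    have hV2 : V ^ 2 ≤ v ^ 2 := by
      have : |v| ^ 2 = v ^ 2 := sq_abs v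
      nlinarith [abs_nonneg v]
    have hlast : Real.exp (-b' * v ^ 2) ≤ Real.exp (-b' * V ^ 2) := by
      rw [Real.exp_le_exp]; nlinarith
    calc ‖F v‖ ≤ K * (1 + |v|) ^ 2 * Real.exp (-b * v ^ 2) := hF v
      _ = K * ((1 + |v|) ^ 2 * Real.exp (-(b / 4) * v ^ 2)) * Real.exp (-b' * v ^ 2)
            * Real.exp (-b' * v ^ 2) := by rw [hsplit]; ring
      _ ≤ K * (2 + 8 / b) * Real.exp (-b' * V ^ 2) * Real.exp (-b' * v ^ 2) := by
          gcongr
          exact one_add_abs_sq_mul_exp_le hb v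
      _ = g v := by rw [hg]
  have htail : ∀ S : Set ℝ, MeasurableSet S → (∀ v ∈ S, V ≤ |v|) →
      ‖∫ v in S, F v‖ ≤ C * Real.sqrt (π / b') := by
    intro S hS hSV
    have h1 : ‖∫ v in S, F v‖ ≤ ∫ v in S, g v := by
      refine norm_integral_le_of_norm_le hgi.integrableOn ?_
      rw [ae_restrict_iff' hS]
      exact ae_of_all _ fun v hv => hpt v (hSV v hv)
    have h2 : ∫ v in S, g v ≤ ∫ v, g v := setIntegral_le_integral hgi hg0
    linarith [hgint]
  have hI := htail (Set.Iic (-V)) measurableSet_Iic fun v hv => by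
    rw [Set.mem_Iic] at hv
    rw [abs_of_nonpos (by linarith)]; linarith
  have hO := htail (Set.Ioi V) measurableSet_Ioi fun v hv => by
    rw [Set.mem_Ioi] at hv
    rw [abs_of_pos (by linarith)]; linarith
  calc ‖∫ v in Set.Iic (-V), F v‖ + ‖∫ v in Set.Ioi V, F v‖
      ≤ C * Real.sqrt (π / b') + C * Real.sqrt (π / b') := add_le_add hI hO
    _ = 2 * (K * (2 + 8 / b) * Real.sqrt (π / (3 * b / 8)) * Real.exp (-(3 * b / 8) * V ^ 2)) := by
        rw [hC, hb']; ring

/-! ## Absorbing polynomial factors into `P^{1/4} = e^{𝓛⁹/4}` -/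

/-- `ℓ^k ≤ e^{ℓ⁹/4}` for `ℓ ≥ 3` and `4k ≤ 6561 = 3⁸` (since `ℓ ≤ e^ℓ` and `kℓ ≤ ℓ⁹/4`).
[folklore] -/
private theorem pow_le_exp_pow_nine {ℓ : ℝ} (hℓ : 3 ≤ ℓ) {k : ℕ} (hk : 4 * (k : ℝ) ≤ 6561) :
    ℓ ^ k ≤ Real.exp (ℓ ^ 9 / 4) := by
  have h1 : ℓ ≤ Real.exp ℓ := by linarith [Real.add_one_le_exp ℓ]
  have h2 : ℓ ^ k ≤ Real.exp ℓ ^ k := pow_le_pow_left₀ (by linarith) h1 k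
  rw [← Real.exp_nat_mul] at h2
  refine h2.trans (Real.exp_le_exp.mpr ?_)
  have h8 : (3 : ℝ) ^ 8 ≤ ℓ ^ 8 := pow_le_pow_left₀ (by norm_num) hℓ 8
  have : ℓ ^ 9 = ℓ ^ 8 * ℓ := by ring
  nlinarith

/-- **`𝓛^k ≤ P^{1/4}`** in the form `ell D ^ k ≤ exp(ell D ^ 9 / 4)` for `ell D ≥ 3`, `4k ≤ 6561`.
[cite: Zhang2022LandauSiegel, §2 (2.6)] -/
theorem pow_ell_le_exp {D : ℕ} (hL : 3 ≤ ell D) {k : ℕ} (hk : 4 * (k : ℝ) ≤ 6561) :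
    ell D ^ k ≤ Real.exp (ell D ^ 9 / 4) :=
  pow_le_exp_pow_nine hL hk

/-- **`D^k ≤ P^{1/4}`**: `(D:ℝ)^k = e^{kℓ} ≤ exp(ell D ^ 9 / 4)` for `ell D ≥ 3`, `4k ≤ 6561`.
[cite: Zhang2022LandauSiegel, §2 (2.6)] -/
theorem pow_D_le_exp {D : ℕ} (hD : 0 < D) (hL : 3 ≤ ell D) {k : ℕ} (hk : 4 * (k : ℝ) ≤ 6561) :
    (D : ℝ) ^ k ≤ Real.exp (ell D ^ 9 / 4) := by
  have hD' : (0 : ℝ) < D := by exact_mod_cast hD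
  have h1 : (D : ℝ) ^ k = Real.exp (k * ell D) := by
    rw [ell, ← Real.exp_log (pow_pos hD' k), Real.log_pow]
  rw [h1, Real.exp_le_exp]
  have h8 : (3 : ℝ) ^ 8 ≤ ell D ^ 8 := pow_le_pow_left₀ (by norm_num) hL 8
  have : ell D ^ 9 = ell D ^ 8 * ell D := by ring
  nlinarith

/-- **constants `≤ P^{1/4}`**: `c ≤ exp(ell D ^ 9 / 4)` whenever `c ≤ 2^100` and `ell D ≥ 3`.
[cite: Zhang2022LandauSiegel, §2 (2.6)] -/
theorem const_le_exp {D : ℕ} (hL : 3 ≤ ell D) {c : ℝ} (hc : c ≤ 2 ^ 100) :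
    c ≤ Real.exp (ell D ^ 9 / 4) := by
  refine hc.trans ?_
  have h9 : (3 : ℝ) ^ 9 ≤ ell D ^ 9 := pow_le_pow_left₀ (by norm_num) hL 9
  have h70 : (2 : ℝ) ^ 100 ≤ Real.exp 70 := by
    have he := Real.exp_one_gt_d9
    have h : (2 : ℝ) ^ 100 ≤ (2.7182818283 : ℝ) ^ 70 := by norm_num
    refine h.trans ?_
    rw [show (70 : ℝ) = (70 : ℕ) * 1 by norm_num, Real.exp_nat_mul]
    exact pow_le_pow_left₀ (by norm_num) he.le 70
  exact h70.trans (Real.exp_le_exp.mpr (by nlinarith))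

end Literature.NumberTheory.LFunctions.Zhang2022.Section4
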